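import Literature.NumberTheory.GaloisRepresentations.LubinTateColemanReflectionTwo
import HarnessLib

/-!
# Principal units of a dyadic local field with `q = 2`, `e = 1` (`𝒪_F/π = 𝔽₂`, `2 = π·unit`): the filtration `U_n = 1 + π^n 𝒪_F`,
# squaring `U_n → U_{n+1}` (exact from `n ≥ 2`, `U_1² ⊆ U_3`), lifting the exponent, and `γ = 1 + π²w` topologically generates `U_2`

Serre, *A Course in Arithmetic* (1973), Ch. II §3.2–3.3 (structure of `ℤ₂^× = {±1} × (1 + 4ℤ₂)`, `1 + 4ℤ₂` topologically cyclic
generated by `5`, squares `(1 + 2ℤ₂)² = 1 + 8ℤ₂`); Neukirch, *Algebraic Number Theory* (1999), Ch. II §5 Prop. (5.7) (the higher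
unit groups `U^{(n)}`), §4 Lemma (4.6) (Hensel).  De Shalit, *Iwasawa theory of elliptic curves with complex multiplication* (1987),
Ch. I §3.1 (`p = 2`: `𝒢 ≅ ℤ_p^×`, `Δ = {±1}`), Ch. II §4.12 (29)–(33) (the auxiliary ideals `𝔞₁, 𝔞₂` must make `σ_{𝔞₁} − N𝔞₁`,
`σ_{𝔞₂} − N𝔞₂` relatively prime — on the series side this is a NON-VANISHING of the value of a character of `𝒪_F^×` at a point of
`U_2`, see `LubinTateColemanCoordCoinvariantTwistKernelTwo`).

For a non-archimedean local field `F` with `|𝓀_F| = 2` and `2 = π·t`, `t ∈ 𝒪_F^×` (i.e. `F` absolutely unramified of residue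
degree one: the situation `K_v = ℚ₂` of the (c)-lane at `p = 2`), writing `U_n := {x : π^n ∣ x − 1}`, THIS file proves
(everything PROVED, 0 sorry, no definitions, no named facts):

* §1 `𝓀_F = 𝔽₂` bookkeeping: every unit is `≡ 1 (π)`, the sum of two units is `≡ 0 (π)`, every unit is `≡ ±1 (π²)`, `−1 ∉ U_2`.
* §2 squaring and products: `U_n·U_n ⊆ U_n`, exact levels multiply (`n ≥ 1`), `x ∈ U_n ⇒ x² ∈ U_{n+1}`, `U_1² ⊆ U_3`, and
  ★ EXACTNESS `x ∈ U_n ∖ U_{n+1}, n ≥ 2 ⇒ x² ∈ U_{n+1} ∖ U_{n+2}`; odd powers keep the exact level; `x^{2^a(2i+1)}` has exact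
  level `n + a` (lifting the exponent at `p = 2` above level `2`).
* §3 ★ `exists_pi_pow_dvd_sub_pow` — **`γ = 1 + π²w` (`w` a unit) topologically generates `U_2`**: for `v ∈ U_2` and every `N`
  there is `j` with `π^N ∣ v − γ^j`.
* (also `pi_pow_dvd_pow_two_pow_sub_one`, `…_succ_sub_one_of_isUnit`: `U_1^{2^{a+1}} ⊆ U_{a+3}`; `exists_pi_pow_dvd_not_dvd_succ`: the exact
  level exists.)  The sequel `LocalFieldDyadicCharacterKernel` adds square roots on `U_3` (Hensel) and the KERNEL THEOREM for characters
  `ψ : 𝒪_F^× → 𝒪_F^×` with `ψ(γ) ∈ U_2 ∖ {1}`.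

## References
* J.-P. Serre, *A Course in Arithmetic* (1973), Ch. II §3.2 Thm. 3 and its proof, §3.3. [Serre1973CourseArithmetic]
* J.-P. Serre, *Local Fields* (1979), Ch. I §1 (discrete valuation rings: uniformiser, units, `𝓂 = (π)`). [SerreLocalFields1979]
* J. Neukirch, *Algebraic Number Theory* (1999), Ch. II §4 Lemma (4.6), §5 Prop. (5.7). [NeukirchANT1999]
* E. de Shalit, *Iwasawa theory of elliptic curves with complex multiplication* (1987), Ch. I §3.1; Ch. II §4.12 (29)–(33). [deShalit1987]
-/

noncomputable section

namespace Literature.NumberTheory.GaloisRepresentations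

section DyadicPrincipalUnits

open GaloisRepresentations.IsNonarchimedeanLocalField LubinTate ValuativeRel

variable {F : Type} [Field F] [ValuativeRel F] [TopologicalSpace F] [IsNonarchimedeanLocalField F]

attribute [local instance] ltNormUniformSpace ltNormIsUniformAddGroup rk1 nF nE fintypeResidueField

variable {π : 𝒪[F]} (hπ : (valuation F).IsUniformizer (π : F)) (hq : residueFieldCard F = 2)
variable {t : 𝒪[F]ˣ} (ht : (2 : 𝒪[F]) = π * t)

/-! ### §1. `𝓀_F = 𝔽₂`: units are `≡ 1 (π)`, `≡ ±1 (π²)` -/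

include hπ in
/-- `π` is not a unit. [cite: SerreLocalFields1979, Ch. I §1] -/
theorem not_isUnit_uniformizer : ¬ IsUnit π := fun h =>
  (IsLocalRing.notMem_maximalIdeal.mpr h) ((mem_maximalIdeal_iff_valuation_lt_one _).mpr hπ.val_lt_one)

include hπ in
/-- `π ∣ x ↔ x ∈ 𝓂_F`. [cite: SerreLocalFields1979, Ch. I §1] -/
theorem uniformizer_dvd_iff_mem_maximalIdeal {x : 𝒪[F]} : π ∣ x ↔ x ∈ 𝓂[F] := by
  rw [maximalIdeal_eq_span_singleton hπ, Ideal.mem_span_singleton]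

include hπ in
/-- `x` is a unit iff `π ∤ x`. [cite: SerreLocalFields1979, Ch. I §1] -/
theorem isUnit_iff_not_uniformizer_dvd {x : 𝒪[F]} : IsUnit x ↔ ¬ π ∣ x := by
  rw [uniformizer_dvd_iff_mem_maximalIdeal hπ, ← IsLocalRing.notMem_maximalIdeal]

omit [TopologicalSpace F] [IsNonarchimedeanLocalField F] in
/-- A unit times something divisible by `π^k`: `π^k ∣ a·y`, `y` a unit ⟹ `π^k ∣ a`. [cite: SerreLocalFields1979, Ch. I §1] -/
theorem pi_pow_dvd_of_dvd_mul_isUnit {k : ℕ} {a y : 𝒪[F]} (hy : IsUnit y) (h : π ^ k ∣ a * y) : π ^ k ∣ a := by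
  obtain ⟨y', hy'⟩ := hy.exists_right_inv
  have h2 : π ^ k ∣ a * y * y' := h.mul_right y'
  rwa [mul_assoc, hy', mul_one] at h2

include hπ in
/-- `π^{k+1} ∤ π^k · y` for a unit `y`. [cite: SerreLocalFields1979, Ch. I §1] -/
theorem not_pi_pow_succ_dvd_pi_pow_mul_isUnit {k : ℕ} {y : 𝒪[F]} (hy : IsUnit y) : ¬ π ^ (k + 1) ∣ π ^ k * y := by
  intro h
  have hπ0 : (π : 𝒪[F]) ^ k ≠ 0 := pow_ne_zero _ fun h0 => hπ.ne_zero (congrArg Subtype.val h0)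
  rw [pow_succ] at h
  obtain ⟨c, hc⟩ := h
  have h1 : y = π * c := mul_left_cancel₀ hπ0 (by rw [hc, mul_assoc])
  exact (isUnit_iff_not_uniformizer_dvd hπ).mp hy ⟨c, h1⟩

include hπ hq in
/-- At `q = 2` every unit is `≡ 1 (mod π)` (`𝓀_F = {0, 1}`). [cite: deShalit1987, Ch. I §3.1] -/
theorem uniformizer_dvd_sub_one_of_isUnit {x : 𝒪[F]} (hx : IsUnit x) : π ∣ x - 1 := by
  rw [uniformizer_dvd_iff_mem_maximalIdeal hπ]
  rcases eq_zero_or_eq_one_two hq (IsLocalRing.residue 𝒪[F] x) with h | h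
  · exact absurd ((IsLocalRing.residue_eq_zero_iff _).mp h) (IsLocalRing.notMem_maximalIdeal.mpr hx)
  · rw [← IsLocalRing.residue_eq_zero_iff, map_sub, map_one, h, sub_self]

include hπ in
/-- `x ≡ 1 (mod π)` ⟹ `x` is a unit. [cite: SerreLocalFields1979, Ch. I §1] -/
theorem isUnit_of_uniformizer_dvd_sub_one {x : 𝒪[F]} (hx : π ∣ x - 1) : IsUnit x := by
  by_contra hna
  have hmem : x ∈ 𝓂[F] := (IsLocalRing.mem_maximalIdeal _).mpr hna
  have h1 : (1 : 𝒪[F]) ∈ 𝓂[F] := by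
    have e : (1 : 𝒪[F]) = x - (x - 1) := by ring
    rw [e]
    exact sub_mem hmem ((uniformizer_dvd_iff_mem_maximalIdeal hπ).mp hx)
  exact (IsLocalRing.maximalIdeal.isMaximal 𝒪[F]).ne_top ((Ideal.eq_top_iff_one _).mpr h1)

include hπ in
/-- `x ∈ U_n` (`n ≥ 1`) ⟹ `x` is a unit. [cite: SerreLocalFields1979, Ch. I §1] -/
theorem isUnit_of_pi_pow_dvd_sub_one {n : ℕ} (hn : 1 ≤ n) {x : 𝒪[F]} (hx : π ^ n ∣ x - 1) : IsUnit x :=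
  isUnit_of_uniformizer_dvd_sub_one hπ ((dvd_pow_self π (by omega)).trans hx)

include hπ hq in
/-- At `q = 2` the sum of two units is `≡ 0 (mod π)` (`1 + 1 = 0` in `𝔽₂`). [cite: deShalit1987, Ch. I §3.1] -/
theorem uniformizer_dvd_add_of_isUnit {a b : 𝒪[F]} (ha : IsUnit a) (hb : IsUnit b) : π ∣ a + b := by
  have h1 := uniformizer_dvd_sub_one_of_isUnit hπ hq ha
  have h2 := uniformizer_dvd_sub_one_of_isUnit hπ hq hb
  have h3 : π ∣ (2 : 𝒪[F]) := by
    rcases eq_zero_or_eq_one_two hq (IsLocalRing.residue 𝒪[F] 2) with h | h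
    · exact (uniformizer_dvd_iff_mem_maximalIdeal hπ).mpr ((IsLocalRing.residue_eq_zero_iff _).mp h)
    · have h' : IsLocalRing.residue 𝒪[F] (2 - 1) = 0 := by rw [map_sub, h, map_one, sub_self]
      norm_num at h'
  have e : a + b = (a - 1) + (b - 1) + 2 := by ring
  rw [e]
  exact dvd_add (dvd_add h1 h2) h3

include hπ ht in
/-- With `2 = π·t`, `t` a unit: `π² ∤ 2`, i.e. **`−1 ∉ U_2`** (`−1 − 1 = −2`). [cite: Serre1973CourseArithmetic, Ch. II §3.3] -/
theorem not_pi_sq_dvd_neg_one_sub_one : ¬ π ^ 2 ∣ (-1 : 𝒪[F]) - 1 := by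
  intro h
  have e : (-1 : 𝒪[F]) - 1 = -(π ^ 1 * t) := by rw [pow_one, ← ht]; norm_num
  rw [e, dvd_neg] at h
  exact not_pi_pow_succ_dvd_pi_pow_mul_isUnit hπ t.isUnit h

include hπ hq ht in
/-- At `q = 2`, `e = 1`: **every unit is `≡ 1` or `≡ −1 (mod π²)`** (`𝒪/π² = {0, 1, π, 1+π}`, `−1 ≡ 1 + π`).
[cite: Serre1973CourseArithmetic, Ch. II §3.3] -/
theorem pi_sq_dvd_sub_one_or_add_one {x : 𝒪[F]} (hx : IsUnit x) : π ^ 2 ∣ x - 1 ∨ π ^ 2 ∣ x + 1 := by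
  obtain ⟨a, ha⟩ := uniformizer_dvd_sub_one_of_isUnit hπ hq hx
  by_cases hpa : π ∣ a
  · left
    obtain ⟨c, hc⟩ := hpa
    exact ⟨c, by rw [ha, hc, pow_two, mul_assoc]⟩
  · right
    have hau : IsUnit a := (isUnit_iff_not_uniformizer_dvd hπ).mpr hpa
    obtain ⟨c, hc⟩ := uniformizer_dvd_add_of_isUnit hπ hq hau t.isUnit
    refine ⟨c, ?_⟩
    have e : x + 1 = (x - 1) + 2 := by ring
    rw [e, ha, ht, ← mul_add, hc, pow_two, mul_assoc]

/-! ### §2. Products, squares, powers: the levels -/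

omit [TopologicalSpace F] [IsNonarchimedeanLocalField F] in
/-- `U_n` is closed under products: `π^n ∣ x − 1`, `π^n ∣ y − 1 ⟹ π^n ∣ xy − 1`. [cite: NeukirchANT1999, Ch. II §5 Prop. (5.7)] -/
theorem pi_pow_dvd_mul_sub_one {n : ℕ} {x y : 𝒪[F]} (hx : π ^ n ∣ x - 1) (hy : π ^ n ∣ y - 1) : π ^ n ∣ x * y - 1 := by
  have e : x * y - 1 = (x - 1) * y + (y - 1) := by ring
  rw [e]
  exact dvd_add (hx.mul_right y) hy

omit [TopologicalSpace F] [IsNonarchimedeanLocalField F] in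
/-- `U_n` is closed under powers. [cite: NeukirchANT1999, Ch. II §5 Prop. (5.7)] -/
theorem pi_pow_dvd_pow_sub_one {n : ℕ} {x : 𝒪[F]} (hx : π ^ n ∣ x - 1) (k : ℕ) : π ^ n ∣ x ^ k - 1 := by
  induction k with
  | zero => simp
  | succ k ih => rw [pow_succ]; exact pi_pow_dvd_mul_sub_one ih hx

omit [TopologicalSpace F] [IsNonarchimedeanLocalField F] in
/-- `U_n` is closed under inverses (units). [cite: NeukirchANT1999, Ch. II §5 Prop. (5.7)] -/
theorem pi_pow_dvd_units_inv_sub_one {n : ℕ} {v : 𝒪[F]ˣ} (hv : π ^ n ∣ (v : 𝒪[F]) - 1) : π ^ n ∣ ((v⁻¹ : 𝒪[F]ˣ) : 𝒪[F]) - 1 := by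
  have e : ((v⁻¹ : 𝒪[F]ˣ) : 𝒪[F]) - 1 = -(((v⁻¹ : 𝒪[F]ˣ) : 𝒪[F]) * ((v : 𝒪[F]) - 1)) := by
    rw [mul_sub, mul_one, Units.inv_mul, neg_sub]
  rw [e, dvd_neg]
  exact hv.mul_left _

include hπ in
/-- ★ An exact level times a deeper element keeps the exact level: `x ∈ U_n ∖ U_{n+1}`, `y ∈ U_{n+1} ⟹ xy ∉ U_{n+1}`.
[cite: NeukirchANT1999, Ch. II §5 Prop. (5.7)] -/
theorem not_pi_pow_succ_dvd_mul_sub_one {n : ℕ} {x y : 𝒪[F]} (hx' : ¬ π ^ (n + 1) ∣ x - 1) (hy : π ^ (n + 1) ∣ y - 1) :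
    ¬ π ^ (n + 1) ∣ x * y - 1 := by
  intro h
  have hyu : IsUnit y := isUnit_of_pi_pow_dvd_sub_one hπ (by omega) hy
  have e : (x - 1) * y = (x * y - 1) - (y - 1) := by ring
  exact hx' (pi_pow_dvd_of_dvd_mul_isUnit hyu (e ▸ dvd_sub h hy))

include hπ hq in
/-- ★ **Two elements of the SAME exact level `n ≥ 1` multiply into `U_{n+1}`** (`U_n/U_{n+1} ≅ 𝓀_F = 𝔽₂`).
[cite: Serre1973CourseArithmetic, Ch. II §3.3] -/
theorem pi_pow_succ_dvd_mul_sub_one_of_not_dvd {n : ℕ} (hn : 1 ≤ n) {x y : 𝒪[F]} (hx : π ^ n ∣ x - 1)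
    (hx' : ¬ π ^ (n + 1) ∣ x - 1) (hy : π ^ n ∣ y - 1) (hy' : ¬ π ^ (n + 1) ∣ y - 1) : π ^ (n + 1) ∣ x * y - 1 := by
  obtain ⟨a, ha⟩ := hx
  obtain ⟨b, hb⟩ := hy
  have hau : IsUnit a := (isUnit_iff_not_uniformizer_dvd hπ).mpr fun ⟨c, hc⟩ => hx' ⟨c, by rw [ha, hc, pow_succ, mul_assoc]⟩
  have hbu : IsUnit b := (isUnit_iff_not_uniformizer_dvd hπ).mpr fun ⟨c, hc⟩ => hy' ⟨c, by rw [hb, hc, pow_succ, mul_assoc]⟩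
  obtain ⟨c, hc⟩ := uniformizer_dvd_add_of_isUnit hπ hq hau hbu
  obtain ⟨n', rfl⟩ : ∃ n', n = n' + 1 := ⟨n - 1, by omega⟩
  have e : x * y - 1 = π ^ (n' + 1) * (a + b) + π ^ (n' + 1) * (π ^ (n' + 1) * (a * b)) := by
    have ex : x = π ^ (n' + 1) * a + 1 := by rw [← ha]; ring
    have ey : y = π ^ (n' + 1) * b + 1 := by rw [← hb]; ring
    rw [ex, ey]; ring
  rw [e, hc]
  refine dvd_add ⟨c, by ring⟩ ⟨π ^ n' * (a * b), by ring⟩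

omit [TopologicalSpace F] [IsNonarchimedeanLocalField F] in
include ht in
/-- `x ∈ U_n`, `n ≥ 1 ⟹ x² ∈ U_{n+1}` (`x² − 1 = (x−1)(x+1)`, `π ∣ x + 1`). [cite: Serre1973CourseArithmetic, Ch. II §3.3] -/
theorem pi_pow_succ_dvd_sq_sub_one {n : ℕ} (hn : 1 ≤ n) {x : 𝒪[F]} (hx : π ^ n ∣ x - 1) : π ^ (n + 1) ∣ x ^ 2 - 1 := by
  have h1 : π ∣ x + 1 := by
    have e : x + 1 = (x - 1) + π * t := by rw [← ht]; ring
    rw [e]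
    exact dvd_add ((dvd_pow_self π (by omega)).trans hx) (dvd_mul_right π _)
  have e : x ^ 2 - 1 = (x - 1) * (x + 1) := by ring
  rw [e, pow_succ]
  exact mul_dvd_mul hx h1

include hπ hq ht in
/-- **`U_1² ⊆ U_3`**: the square of EVERY unit is `≡ 1 (mod π³)` (`(1+πa)² − 1 = π²·a(t + a)` and `a(t+a) ≡ a(1+a) ≡ 0` in `𝔽₂`;
`(ℤ₂^×)² ⊆ 1 + 8ℤ₂`). [cite: Serre1973CourseArithmetic, Ch. II §3.3] -/
theorem pi_pow_three_dvd_sq_sub_one {x : 𝒪[F]} (hx : IsUnit x) : π ^ 3 ∣ x ^ 2 - 1 := by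
  obtain ⟨a, ha⟩ := uniformizer_dvd_sub_one_of_isUnit hπ hq hx
  have e : x ^ 2 - 1 = π ^ 2 * (a * (t + a)) := by
    have ex : x = π * a + 1 := by rw [← ha]; ring
    rw [ex]
    linear_combination (π * a) * ht
  rw [e, pow_succ]
  refine mul_dvd_mul_left _ ?_
  by_cases hpa : π ∣ a
  · exact hpa.mul_right _
  · exact (uniformizer_dvd_add_of_isUnit hπ hq t.isUnit ((isUnit_iff_not_uniformizer_dvd hπ).mpr hpa)).mul_left _

include hπ ht in
/-- ★ **EXACTNESS of squaring from level `2`**: `x ∈ U_n ∖ U_{n+1}`, `n ≥ 2 ⟹ x² ∉ U_{n+2}` (`x + 1 = π(t + π^{n−1}a)` has exact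
level `1`).  [cite: Serre1973CourseArithmetic, Ch. II §3.3] -/
theorem not_pi_pow_dvd_sq_sub_one {n : ℕ} (hn : 2 ≤ n) {x : 𝒪[F]} (hx : π ^ n ∣ x - 1) (hx' : ¬ π ^ (n + 1) ∣ x - 1) :
    ¬ π ^ (n + 2) ∣ x ^ 2 - 1 := by
  obtain ⟨a, ha⟩ := hx
  have hau : IsUnit a := (isUnit_iff_not_uniformizer_dvd hπ).mpr fun ⟨c, hc⟩ => hx' ⟨c, by rw [ha, hc, pow_succ, mul_assoc]⟩
  obtain ⟨n', rfl⟩ : ∃ n', n = n' + 2 := ⟨n - 2, by omega⟩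
  -- `x + 1 = π (t + π^{n'+1} a)` with a unit cofactor
  have hcu : IsUnit ((t : 𝒪[F]) + π ^ (n' + 1) * a) := by
    rw [isUnit_iff_not_uniformizer_dvd hπ]
    intro hd
    have : π ∣ (t : 𝒪[F]) := by
      have e : (t : 𝒪[F]) = ((t : 𝒪[F]) + π ^ (n' + 1) * a) - π * (π ^ n' * a) := by ring
      rw [e]
      exact dvd_sub hd (dvd_mul_right π _)
    exact (isUnit_iff_not_uniformizer_dvd hπ).mp t.isUnit this
  have e : x ^ 2 - 1 = π ^ (n' + 2 + 1) * (a * ((t : 𝒪[F]) + π ^ (n' + 1) * a)) := by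
    have ex : x = π ^ (n' + 2) * a + 1 := by rw [← ha]; ring
    rw [ex]
    linear_combination (π ^ (n' + 2) * a) * ht
  rw [e]
  exact not_pi_pow_succ_dvd_pi_pow_mul_isUnit hπ (hau.mul hcu)

include hπ ht in
/-- Odd powers keep the exact level (`n ≥ 1`): `x ∈ U_n ∖ U_{n+1} ⟹ x^{2i+1} ∉ U_{n+1}`. [cite: Serre1973CourseArithmetic, Ch. II §3.3] -/
theorem not_pi_pow_succ_dvd_pow_odd_sub_one {n : ℕ} (hn : 1 ≤ n) {x : 𝒪[F]} (hx : π ^ n ∣ x - 1) (hx' : ¬ π ^ (n + 1) ∣ x - 1)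
    (i : ℕ) : ¬ π ^ (n + 1) ∣ x ^ (2 * i + 1) - 1 := by
  have e : x ^ (2 * i + 1) = x * (x ^ 2) ^ i := by rw [pow_succ, pow_mul, mul_comm]
  rw [e]
  exact not_pi_pow_succ_dvd_mul_sub_one hπ hx' (pi_pow_dvd_pow_sub_one (pi_pow_succ_dvd_sq_sub_one ht hn hx) i)

include hπ ht in
/-- ★ **Lifting the exponent for `2^a`-th powers above level `2`**: `x ∈ U_n ∖ U_{n+1}`, `n ≥ 2 ⟹ x^{2^a} ∈ U_{n+a} ∖ U_{n+a+1}`.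
[cite: Serre1973CourseArithmetic, Ch. II §3.3] -/
theorem pi_pow_dvd_pow_two_pow_sub_one_and_not {n : ℕ} (hn : 2 ≤ n) {x : 𝒪[F]} (hx : π ^ n ∣ x - 1) (hx' : ¬ π ^ (n + 1) ∣ x - 1)
    (a : ℕ) : π ^ (n + a) ∣ x ^ 2 ^ a - 1 ∧ ¬ π ^ (n + a + 1) ∣ x ^ 2 ^ a - 1 := by
  induction a with
  | zero => simpa using ⟨hx, hx'⟩
  | succ a ih =>
    rw [pow_succ, pow_mul]
    refine ⟨?_, ?_⟩
    · have h := pi_pow_succ_dvd_sq_sub_one ht (by omega) ih.1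
      rwa [show n + a + 1 = n + (a + 1) by ring] at h
    · have h := not_pi_pow_dvd_sq_sub_one hπ ht (by omega) ih.1 ih.2
      rwa [show n + a + 2 = n + (a + 1) + 1 by ring] at h

include hπ ht in
/-- ★ **`x ∈ U_n ∖ U_{n+1}`, `n ≥ 2 ⟹ x^{2^a(2i+1)}` has exact level `n + a`.** [cite: Serre1973CourseArithmetic, Ch. II §3.3] -/
theorem pi_pow_dvd_pow_sub_one_and_not {n : ℕ} (hn : 2 ≤ n) {x : 𝒪[F]} (hx : π ^ n ∣ x - 1) (hx' : ¬ π ^ (n + 1) ∣ x - 1)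
    (a i : ℕ) : π ^ (n + a) ∣ x ^ (2 ^ a * (2 * i + 1)) - 1 ∧ ¬ π ^ (n + a + 1) ∣ x ^ (2 ^ a * (2 * i + 1)) - 1 := by
  have hodd := not_pi_pow_succ_dvd_pow_odd_sub_one hπ ht (by omega : 1 ≤ n) hx hx' i
  have h := pi_pow_dvd_pow_two_pow_sub_one_and_not hπ ht hn (pi_pow_dvd_pow_sub_one hx (2 * i + 1)) hodd a
  rwa [← pow_mul, mul_comm (2 * i + 1)] at h

/-! ### §3. `γ = 1 + π²w` topologically generates `U_2` -/

include hπ ht in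
/-- `γ = 1 + π²w`, `w` a unit: `γ^{2^a}` has exact level `a + 2`. [cite: Serre1973CourseArithmetic, Ch. II §3.3] -/
theorem pi_pow_dvd_gen_pow_two_pow_sub_one_and_not {γ w : 𝒪[F]ˣ} (hγ : (γ : 𝒪[F]) = 1 + π ^ 2 * w) (a : ℕ) :
    π ^ (2 + a) ∣ (γ : 𝒪[F]) ^ 2 ^ a - 1 ∧ ¬ π ^ (2 + a + 1) ∣ (γ : 𝒪[F]) ^ 2 ^ a - 1 :=
  pi_pow_dvd_pow_two_pow_sub_one_and_not hπ ht le_rfl ⟨w, by rw [hγ, add_sub_cancel_left]⟩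
    (by rw [hγ, add_sub_cancel_left]; exact not_pi_pow_succ_dvd_pi_pow_mul_isUnit hπ w.isUnit) a

include hπ hq ht in
/-- ★ **`γ = 1 + π²w` topologically generates `U_2`**: for `v ∈ U_2` and every `N` there is an exponent `j` with `π^N ∣ v − γ^j`
(induction on `N`: if `v − γ^j` has exact level `N ≥ 2`, so has `γ^{2^{N−2}} − 1`, and the two cancel modulo `π^{N+1}` since
`U_N/U_{N+1} = 𝔽₂`).  [cite: Serre1973CourseArithmetic, Ch. II §3.2 Thm. 3 (proof), §3.3] -/
theorem exists_pi_pow_dvd_sub_gen_pow {γ w : 𝒪[F]ˣ} (hγ : (γ : 𝒪[F]) = 1 + π ^ 2 * w) {v : 𝒪[F]} (hv : π ^ 2 ∣ v - 1) (N : ℕ) :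
    ∃ j : ℕ, π ^ N ∣ v - (γ : 𝒪[F]) ^ j := by
  induction N with
  | zero => exact ⟨0, by simp⟩
  | succ N ih =>
    obtain ⟨j, hj⟩ := ih
    by_cases hN : N + 1 ≤ 2
    · exact ⟨0, by rw [pow_zero]; exact (pow_dvd_pow π hN).trans hv⟩
    by_cases hdeep : π ^ (N + 1) ∣ v - (γ : 𝒪[F]) ^ j
    · exact ⟨j, hdeep⟩
    -- `v γ^{-j}` and `γ^{2^{N-2}}` both have exact level `N`
    obtain ⟨N', rfl⟩ : ∃ N', N = N' + 2 := ⟨N - 2, by omega⟩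
    refine ⟨j + 2 ^ N', ?_⟩
    -- work with `u := v * (γ^j)⁻¹`
    set gi : 𝒪[F] := (((γ ^ j)⁻¹ : 𝒪[F]ˣ) : 𝒪[F]) with hgi
    set gi' : 𝒪[F] := (((γ ^ 2 ^ N')⁻¹ : 𝒪[F]ˣ) : 𝒪[F]) with hgi'
    have hgi1 : gi * (γ : 𝒪[F]) ^ j = 1 := by rw [hgi, ← Units.val_pow_eq_pow_val, Units.inv_mul]
    have hgi2 : gi' * (γ : 𝒪[F]) ^ 2 ^ N' = 1 := by rw [hgi', ← Units.val_pow_eq_pow_val, Units.inv_mul]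
    have hu : π ^ (N' + 2) ∣ v * gi - 1 := by
      have e : v * gi - 1 = (v - (γ : 𝒪[F]) ^ j) * gi := by linear_combination hgi1
      rw [e]; exact hj.mul_right _
    have hu' : ¬ π ^ (N' + 2 + 1) ∣ v * gi - 1 := by
      intro h
      apply hdeep
      have e : v - (γ : 𝒪[F]) ^ j = (v * gi - 1) * (γ : 𝒪[F]) ^ j := by linear_combination (-v) * hgi1
      rw [e]; exact h.mul_right _
    have hg := pi_pow_dvd_gen_pow_two_pow_sub_one_and_not hπ ht hγ N'
    rw [show 2 + N' = N' + 2 by ring] at hg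
    have hprod := pi_pow_succ_dvd_mul_sub_one_of_not_dvd hπ hq (by omega) hu hu'
      (pi_pow_dvd_units_inv_sub_one (v := γ ^ 2 ^ N') (by rw [Units.val_pow_eq_pow_val]; exact hg.1))
      (by
        intro h
        apply hg.2
        have h' := pi_pow_dvd_units_inv_sub_one (v := (γ ^ 2 ^ N')⁻¹) h
        rwa [inv_inv, Units.val_pow_eq_pow_val] at h')
    -- `v * gi * gi' - 1` divisible ⟹ `v - γ^{j + 2^N'}` divisible
    have e : v - (γ : 𝒪[F]) ^ (j + 2 ^ N') = (v * gi * gi' - 1) * (γ : 𝒪[F]) ^ (j + 2 ^ N') := by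
      rw [pow_add]
      linear_combination (-(v * gi' * (γ : 𝒪[F]) ^ 2 ^ N')) * hgi1 + (-v) * hgi2
    rw [e]
    exact hprod.mul_right _

include ht in
omit [TopologicalSpace F] [IsNonarchimedeanLocalField F] in
/-- `x ∈ U_n`, `n ≥ 1 ⟹ x^{2^a} ∈ U_{n+a}`. [cite: Serre1973CourseArithmetic, Ch. II §3.3] -/
theorem pi_pow_dvd_pow_two_pow_sub_one {n : ℕ} (hn : 1 ≤ n) {x : 𝒪[F]} (hx : π ^ n ∣ x - 1) (a : ℕ) :
    π ^ (n + a) ∣ x ^ 2 ^ a - 1 := by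
  induction a with
  | zero => simpa using hx
  | succ a ih =>
    rw [pow_succ, pow_mul, show n + (a + 1) = n + a + 1 by ring]
    exact pi_pow_succ_dvd_sq_sub_one ht (by omega) ih

include hπ hq ht in
/-- **`U_1^{2^{a+1}} ⊆ U_{a+3}`**: for EVERY unit `x`, `π^{a+3} ∣ x^{2^{a+1}} − 1` (`(ℤ₂^×)^{2^{a+1}} ⊆ 1 + 2^{a+3}ℤ₂`).
[cite: Serre1973CourseArithmetic, Ch. II §3.3] -/
theorem pi_pow_dvd_pow_two_pow_succ_sub_one_of_isUnit {x : 𝒪[F]} (hx : IsUnit x) (a : ℕ) : π ^ (a + 3) ∣ x ^ 2 ^ (a + 1) - 1 := by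
  have e : x ^ 2 ^ (a + 1) = (x ^ 2) ^ 2 ^ a := by rw [pow_succ', pow_mul]
  rw [e, show a + 3 = 3 + a by ring]
  exact pi_pow_dvd_pow_two_pow_sub_one ht (by omega) (pi_pow_three_dvd_sq_sub_one hπ hq ht hx) a

omit [TopologicalSpace F] [IsNonarchimedeanLocalField F] in
/-- The exact level exists between two bounds: `π^a ∣ z`, `π^b ∤ z ⟹ ∃ m ∈ [a, b)`, `π^m ∣ z`, `π^{m+1} ∤ z`. [cite: SerreLocalFields1979, Ch. I §1] -/
theorem exists_pi_pow_dvd_not_dvd_succ {a b : ℕ} {z : 𝒪[F]} (ha : π ^ a ∣ z) (hb : ¬ π ^ b ∣ z) :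
    ∃ m, a ≤ m ∧ m < b ∧ π ^ m ∣ z ∧ ¬ π ^ (m + 1) ∣ z := by
  induction b with
  | zero => exact absurd (by simp) hb
  | succ b ih =>
    by_cases h : π ^ b ∣ z
    · refine ⟨b, ?_, b.lt_succ_self, h, hb⟩
      by_contra hab
      exact hb ((pow_dvd_pow π (by omega)).trans ha)
    · obtain ⟨m, ham, hmb, hm, hm'⟩ := ih h
      exact ⟨m, ham, by omega, hm, hm'⟩

end DyadicPrincipalUnits

end Literature.NumberTheory.GaloisRepresentations
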